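/-
Copyright (c) 2026 the pub-hodgecm-mathlib formalisation cell (harness21).  Prover seat hodgecm-mathlib-K2E5-p17 (g3) (free E5 hand on the E3 road),
Track B «K2-LIT» ∕ h413 (`stmt-HodgeConjecture-24833`), line `K2_E3_EllipticInputs`, unit U12-d, §L road «U-iso-T», brick (G⁺-b) LINE SIDE, part 3:
the line inversion (T1) `∫ X·Ĝ = γ₀ (Z₀(G) + c₀ G(0))` and the truncation identity (T2) for the unramified sign character.  2026-09-04.
-/
import Summits.HodgeConjecture.HodgeConjecture.Theorems.K2E3LocalFieldSignCharZetaBalls   -- ★ part 2 (p857390): `Z₀(1_B)`, Fourier side on cosets; brings part 1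
import HarnessLib

/-!
# K2_E3 road (h413), §L — (G⁺-b) line side, part 3: the LINE INVERSION (T1) and the TRUNCATION IDENTITY (T2), sign-weight form

Cell `pub/hodgecm-mathlib` (D-0151), Track B, seat K2E5-p17 (g3) ((G⁺-b) cut with K2E5-p10 (g4) = K-side, §L lead K2E3-p12 (g4)); frozen interface K2 bus
04:26:40Z + ERRATUM 04:38:32Z ((T2) strict set, ACK 04:40:49Z).  `--supports stmt-HodgeConjecture-24833 --as helper`; THEOREMS ONLY.  COUNT-NEUTRAL.

Frame (parts 1–2): non-archimedean local field `F` (`q = #𝓀`, `𝔭^n = primePowBall F n`), additive Haar `μ`, additive character `ψ` (continuous, conductor exponent `m`),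
and a weight `X : F → ℂ` (measurable, `‖X‖ ≤ 1`, `X = (−1)^j` on the shell `j`, `X 0 = 0`) — the unramified quadratic character extended by zero; `n(s) = ‖s‖⁻¹`;
`Z₀(G) := ∫ X(s) n(s) (G(s) − 1_𝒪(s) G(0)) dμ(s)` written out in full.
* §1 algebra of the constants; §2 the PER-COSET identity `∫ X (1_B)^ = γ₀ (Z₀(1_B) + c₀ 1_B(0))`, `B = a + 𝔭^N`, with
  **`γ₀ = 2 (−1)^m μ(𝔭^m) ∕ (1 + q⁻¹)`**, **`c₀ = (1 − q⁻¹) μ(𝒪) ∕ 2`** (both cases of part 2 collapse to these constants);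
* §3 **(T1)** `integral_sign_mul_fourierSB_eq`: for every `G ∈ SchwartzBruhat F`, `∫ X·Ĝ dμ = γ₀ · (Z₀(G) + c₀ · G 0)` — by the finite coset decomposition of `G`
  (★ `exists_finset_eq_sum_const_mul_indicator`) and linearity of both sides; `exists_lineInversion_consts` is the `∃ γ₀ c₀` form of the frozen interface;
* §4 **(T2)** `setIntegral_compl_primePowBall_even_eventually_eq`: `∀ᶠ n, ∫_{(𝔭^{2n})ᶜ} X n G = Z₀(G)` — EXACT for even exponents (the alternating sum over the
  `2n` shells of `𝒪 ∖ 𝔭^{2n}` vanishes), the strict-set form of the erratum.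
The `QuasiChar` currency (`X := χ̃`, ★ `TateDirect.extend_*`, `χ(ϖ) = −1`) is a pointwise instantiation left to the consumer's file (K-side), as agreed.
[Tate1950, §2.5] [BushnellHenniart2006, §23.5] [WeilBNT1967, Ch. VII §2].
HONEST LABEL: HC_CM is proved only modulo the 7 printed citations (2 remaining named inputs: hLiu418 = stmt-HodgeConjecture-24832, h413 = stmt-HodgeConjecture-24833)
until rung 0 closes; count-neutral.
-/

set_option autoImplicit false
set_option linter.dupNamespace false   -- `Summit.HodgeConjecture.HodgeConjecture.…` (D-0017 nested layout; lakefile exemption for Summits)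

noncomputable section

open MeasureTheory Measure Filter Topology Set
open scoped NNReal ENNReal Pointwise
open Literature.NumberTheory.Automorphic Literature.NumberTheory.Automorphic.LocalFieldHaar
open Literature.NumberTheory.GaloisRepresentations Literature.NumberTheory.GaloisRepresentations.IsNonarchimedeanLocalField
open Summit.HodgeConjecture.HodgeConjecture.Cruxes.H413.K2E3LocalFieldSignCharLineLemmas
open Summit.HodgeConjecture.HodgeConjecture.Cruxes.H413.K2E3LocalFieldSignCharZetaBalls

namespace Summit.HodgeConjecture.HodgeConjecture.Cruxes.H413.K2E3LocalFieldQuadraticCharLineInversion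

variable {F : Type*} [Field F] [ValuativeRel F] [TopologicalSpace F] [IsNonarchimedeanLocalField F] [MeasurableSpace F] [BorelSpace F]
  (μ : Measure F) [μ.IsAddHaarMeasure]
  {X : F → ℂ} (hXm : Measurable X) (hXb : ∀ x, ‖X x‖ ≤ 1)
  (hX : ∀ (j : ℤ) (x : F), x ∈ primePowBall F j \ primePowBall F (j + 1) → X x = (-1) ^ j) (hX0 : X 0 = 0)
  {ϖ : F} (hϖ : normAbs F ϖ = (residueFieldCard F : ℝ≥0)⁻¹)
  (ψ : AddChar F Circle) (hψc : Continuous ψ) {m : ℤ} (hm : ψ.HasConductorExp m)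

/-! ## §1  Constants -/

/-- `(−1)^{m−v} = (−1)^m (−1)^v`. [folklore] -/
theorem neg_one_zpow_sub (m v : ℤ) : ((-1 : ℂ)) ^ (m - v) = (-1) ^ m * (-1) ^ v := by
  have h2 : ((-1 : ℂ)) ^ (v + v) = 1 := by
    rw [← two_mul, zpow_mul]; norm_num
  calc ((-1 : ℂ)) ^ (m - v) = (-1) ^ (m - v) * (-1) ^ (v + v) := by rw [h2, mul_one]
    _ = (-1) ^ m * (-1) ^ v := by
        rw [← zpow_add₀ (by norm_num : (-1 : ℂ) ≠ 0), show m - v + (v + v) = m + v by ring, zpow_add₀ (by norm_num : (-1 : ℂ) ≠ 0)]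

/-- `μ(𝔭^{m−v}) = q^v μ(𝔭^m)`. [folklore] -/
theorem measureReal_primePowBall_sub (m v : ℤ) :
    (μ.real (primePowBall F (m - v)) : ℂ) = (residueFieldCard F : ℂ) ^ v * (μ.real (primePowBall F m) : ℂ) := by
  have hq : (residueFieldCard F : ℂ) ≠ 0 := Nat.cast_ne_zero.2 (residueFieldCard_ne_zero F)
  rw [measureReal_primePowBall μ (m - v), measureReal_primePowBall μ m]
  push_cast
  have h1 : ((residueFieldCard F : ℂ))⁻¹ ^ (m - v) = ((residueFieldCard F : ℂ))⁻¹ ^ m * (residueFieldCard F : ℂ) ^ v := by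
    rw [zpow_sub₀ (inv_ne_zero hq), div_eq_mul_inv, ← zpow_neg, inv_zpow' _ (-v), neg_neg]
  rw [h1]
  ring

/-- `μ(𝔭^N) μ(𝔭^{m−N}) = μ(𝔭^m) μ(𝒪)`. [folklore] -/
theorem measureReal_primePowBall_mul (N m : ℤ) :
    (μ.real (primePowBall F N) : ℂ) * (μ.real (primePowBall F (m - N)) : ℂ) =
      (μ.real (primePowBall F m) : ℂ) * (μ.real (primePowBall F 0) : ℂ) := by
  have hq : (residueFieldCard F : ℂ) ≠ 0 := Nat.cast_ne_zero.2 (residueFieldCard_ne_zero F)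
  rw [measureReal_primePowBall μ N, measureReal_primePowBall μ (m - N), measureReal_primePowBall μ m]
  push_cast
  rw [show ((residueFieldCard F : ℂ))⁻¹ ^ m = ((residueFieldCard F : ℂ))⁻¹ ^ N * ((residueFieldCard F : ℂ))⁻¹ ^ (m - N) by
    rw [← zpow_add₀ (inv_ne_zero hq)]; congr 1; ring]
  ring

/-- Integrability of `c · 1_B` for a coset `B = a + 𝔭^N` (★, transported along the set equation). [folklore] -/
theorem integrable_const_mul_indicator_of_eq {B : Set F} {a : F} {N : ℤ} (hB : B = a +ᵥ primePowBall F N) (c : ℂ) :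
    Integrable (fun u => c * B.indicator (fun _ => (1 : ℂ)) u) μ := by
  subst hB
  exact integrable_const_mul_indicator_vadd_primePowBall μ c a N

omit [ValuativeRel F] [TopologicalSpace F] [IsNonarchimedeanLocalField F] [BorelSpace F] [μ.IsAddHaarMeasure] in
/-- constants come out of the Fourier transform. [folklore] -/
theorem fourierSB_const_mul (c : ℂ) (g : F → ℂ) :
    fourierSB ψ μ (fun x => c * g x) = fun y => c * fourierSB ψ μ g y := by
  funext y
  rw [fourierSB_apply, fourierSB_apply, ← integral_const_mul]
  refine integral_congr_ae (Filter.Eventually.of_forall fun x => ?_)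
  simp only
  ring

/-! ## §2  The per-coset identity -/

omit [MeasurableSpace F] [BorelSpace F] in
/-- `a ∈ 𝔭^N ⇒ a + 𝔭^N = 𝔭^N`. [folklore] -/
theorem vadd_primePowBall_eq_self {a : F} {N : ℤ} (ha : a ∈ primePowBall F N) : a +ᵥ primePowBall F N = primePowBall F N := by
  have h0 : (0 : F) ∈ a +ᵥ primePowBall F N := by
    rw [mem_vadd_primePowBall_iff, zero_sub]; exact neg_mem_primePowBall ha
  have h := vadd_primePowBall_eq_of_mem h0
  rw [zero_vadd] at h
  exact h.symm

open scoped Classical in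
include hXm hXb hX hX0 hϖ hψc hm in
/-- **Per-coset line inversion**: for `B = a + 𝔭^N`,
`∫ X (1_B)^ dμ = γ₀ · (Z₀(1_B) + c₀ · 1_B(0))`, `γ₀ = 2(−1)^m μ(𝔭^m)∕(1+q⁻¹)`, `c₀ = (1−q⁻¹)μ(𝒪)∕2` — the case `0 ∈ B` by `I(m−N)` and `Z₀(1_{𝔭^N})`, the case `0 ∉ B`
by the twisted ball integral (J) and `Z₀(1_{a+𝔭^N}) = (−1)^v q^v μ(𝔭^N)`. [cite: Tate1950, §2.5] [cite: BushnellHenniart2006, §23.5] -/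
theorem integral_sign_mul_fourierSB_indicator_vadd_eq (a : F) (N : ℤ) :
    ∫ t, X t * fourierSB ψ μ ((a +ᵥ primePowBall F N).indicator fun _ => (1 : ℂ)) t ∂μ =
      (2 * (-1) ^ m * (μ.real (primePowBall F m) : ℂ) / (1 + (residueFieldCard F : ℂ)⁻¹)) *
        ((∫ s, X s * ((((normAbs F s)⁻¹ : ℝ≥0) : ℝ) : ℂ) *
            ((a +ᵥ primePowBall F N).indicator (fun _ => (1 : ℂ)) s -
              (primePowBall F 0).indicator (fun _ => (a +ᵥ primePowBall F N).indicator (fun _ => (1 : ℂ)) 0) s) ∂μ) +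
          ((1 - (residueFieldCard F : ℂ)⁻¹) * (μ.real (primePowBall F 0) : ℂ) / 2) * (a +ᵥ primePowBall F N).indicator (fun _ => (1 : ℂ)) 0) := by
  by_cases ha : a ∈ primePowBall F N
  · -- `B = 𝔭^N`
    rw [integral_sign_mul_fourierSB_indicator_vadd_of_mem μ hXm hXb hX hX0 hϖ ψ hm ha, vadd_primePowBall_eq_self ha,
      Set.indicator_of_mem (zero_mem_primePowBall N), integral_sign_mul_normInv_mul_indicator_sub μ hXm hXb hX N, neg_one_zpow_sub]
    linear_combination ((-1 : ℂ) ^ m * (-1) ^ N * ((1 - (residueFieldCard F : ℂ)⁻¹) / (1 + (residueFieldCard F : ℂ)⁻¹))) *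
      measureReal_primePowBall_mul μ N m
  · -- `0 ∉ B`, `B` in the shell `v < N`
    have ha0 : a ≠ 0 := fun h => ha (h ▸ zero_mem_primePowBall N)
    obtain ⟨v, hv⟩ := exists_normAbs_eq_inv_zpow ha0
    have hvN : v < N := by
      by_contra h
      exact ha ((mem_primePowBall_iff_le hv N).2 (not_lt.1 h))
    have h0B : (0 : F) ∉ a +ᵥ primePowBall F N := fun h => by
      rw [mem_vadd_primePowBall_iff, zero_sub] at h
      exact ha (by simpa using neg_mem_primePowBall h)
    have h0 : (a +ᵥ primePowBall F N).indicator (fun _ => (1 : ℂ)) 0 = 0 := by simp [h0B]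
    rw [integral_sign_mul_fourierSB_indicator_vadd_of_lt μ hXm hXb hX hX0 hϖ ψ hψc hm hv hvN,
      integral_sign_mul_normInv_mul_indicator_vadd μ hX hv hvN, h0, mul_zero, add_zero, neg_one_zpow_sub,
      measureReal_primePowBall_sub μ m v]
    ring

open scoped Classical in
include hXm hXb hX hX0 hϖ hψc hm in
/-- The per-coset identity transported along a set equation `B = a + 𝔭^N`. [cite: Tate1950, §2.5] -/
theorem integral_sign_mul_fourierSB_indicator_eq_of_eq {B : Set F} {a : F} {N : ℤ} (hB : B = a +ᵥ primePowBall F N) :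
    ∫ t, X t * fourierSB ψ μ (B.indicator fun _ => (1 : ℂ)) t ∂μ =
      (2 * (-1) ^ m * (μ.real (primePowBall F m) : ℂ) / (1 + (residueFieldCard F : ℂ)⁻¹)) *
        ((∫ s, X s * ((((normAbs F s)⁻¹ : ℝ≥0) : ℝ) : ℂ) *
            (B.indicator (fun _ => (1 : ℂ)) s - (primePowBall F 0).indicator (fun _ => B.indicator (fun _ => (1 : ℂ)) 0) s) ∂μ) +
          ((1 - (residueFieldCard F : ℂ)⁻¹) * (μ.real (primePowBall F 0) : ℂ) / 2) * B.indicator (fun _ => (1 : ℂ)) 0) := by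
  subst hB
  exact integral_sign_mul_fourierSB_indicator_vadd_eq μ hXm hXb hX hX0 hϖ ψ hψc hm a N

open scoped Classical in
include hXm hXb hX in
/-- Integrability of the regularised integrand `X n (1_B − 1_𝒪 1_B(0))` for a coset `B = a + 𝔭^N`. [folklore] -/
theorem integrable_sign_mul_normInv_mul_indicator_of_eq {B : Set F} {a : F} {N : ℤ} (hB : B = a +ᵥ primePowBall F N) :
    Integrable (fun s => X s * ((((normAbs F s)⁻¹ : ℝ≥0) : ℝ) : ℂ) *
      (B.indicator (fun _ => (1 : ℂ)) s - (primePowBall F 0).indicator (fun _ => B.indicator (fun _ => (1 : ℂ)) 0) s)) μ := by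
  haveI : T2Space F := (isLocalField F).toT2Space
  haveI : LocallyCompactSpace F := (isLocalField F).toLocallyCompactSpace
  subst hB
  by_cases ha : a ∈ primePowBall F N
  · rw [vadd_primePowBall_eq_self ha, Set.indicator_of_mem (zero_mem_primePowBall N)]
    rcases le_or_gt 0 N with hN | hN
    · obtain ⟨k, rfl⟩ := Int.eq_ofNat_of_zero_le hN
      have h : (fun s => X s * ((((normAbs F s)⁻¹ : ℝ≥0) : ℝ) : ℂ) *
          ((primePowBall F (k : ℤ)).indicator (fun _ => (1 : ℂ)) s - (primePowBall F 0).indicator (fun _ => (1 : ℂ)) s)) =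
          fun s => -((primePowBall F 0 \ primePowBall F (k : ℤ)).indicator (fun s => X s * ((((normAbs F s)⁻¹ : ℝ≥0) : ℝ) : ℂ)) s) := by
        funext s
        by_cases h0 : s ∈ primePowBall F 0
        · by_cases hk : s ∈ primePowBall F (k : ℤ)
          · simp [h0, hk]
          · simp [h0, hk]
        · have hk : s ∉ primePowBall F (k : ℤ) := fun h => h0 (primePowBall_antitone (by omega) h)
          simp [h0, hk]
      rw [h]
      exact ((integrable_indicator_iff ((measurableSet_primePowBall 0).diff (measurableSet_primePowBall _))).2
        (integrableOn_sign_mul_normInv μ hXm hXb 0 k)).neg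
    · obtain ⟨k, rfl⟩ : ∃ k : ℕ, N = -(k : ℤ) := ⟨(-N).toNat, by omega⟩
      have h : (fun s => X s * ((((normAbs F s)⁻¹ : ℝ≥0) : ℝ) : ℂ) *
          ((primePowBall F (-(k : ℤ))).indicator (fun _ => (1 : ℂ)) s - (primePowBall F 0).indicator (fun _ => (1 : ℂ)) s)) =
          (primePowBall F (-(k : ℤ)) \ primePowBall F 0).indicator (fun s => X s * ((((normAbs F s)⁻¹ : ℝ≥0) : ℝ) : ℂ)) := by
        funext s
        by_cases hk : s ∈ primePowBall F (-(k : ℤ))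
        · by_cases h0 : s ∈ primePowBall F 0
          · simp [h0, hk]
          · simp [h0, hk]
        · have h0 : s ∉ primePowBall F 0 := fun h => hk (primePowBall_antitone (by omega) h)
          simp [h0, hk]
      rw [h]
      exact (integrable_indicator_iff ((measurableSet_primePowBall _).diff (measurableSet_primePowBall 0))).2
        (integrableOn_sign_mul_normInv μ hXm hXb _ 0)
  · have ha0 : a ≠ 0 := fun h => ha (h ▸ zero_mem_primePowBall N)
    obtain ⟨v, hv⟩ := exists_normAbs_eq_inv_zpow ha0
    have ha' : a ∉ primePowBall F N := ha
    have h0B : (0 : F) ∉ a +ᵥ primePowBall F N := fun h => by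
      rw [mem_vadd_primePowBall_iff, zero_sub] at h
      exact ha (by simpa using neg_mem_primePowBall h)
    have hshell : ∀ s ∈ a +ᵥ primePowBall F N, s ∈ primePowBall F v \ primePowBall F (v + 1) := fun s hs => by
      rw [mem_shell_iff, TateDirect.normAbs_eq_of_sub_mem ha' ((mem_vadd_primePowBall_iff).1 hs), hv]
    have h : (fun s => X s * ((((normAbs F s)⁻¹ : ℝ≥0) : ℝ) : ℂ) *
        ((a +ᵥ primePowBall F N).indicator (fun _ => (1 : ℂ)) s -
          (primePowBall F 0).indicator (fun _ => (a +ᵥ primePowBall F N).indicator (fun _ => (1 : ℂ)) 0) s)) =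
        (a +ᵥ primePowBall F N).indicator (fun _ => ((-1 : ℂ) ^ v * (residueFieldCard F : ℂ) ^ v)) := by
      funext s
      have h0 : (a +ᵥ primePowBall F N).indicator (fun _ => (1 : ℂ)) 0 = 0 := by simp [h0B]
      have h0' : (primePowBall F 0).indicator (fun _ => (a +ᵥ primePowBall F N).indicator (fun _ => (1 : ℂ)) 0) s = 0 := by
        rw [h0]; exact Set.indicator_apply_eq_zero.2 fun _ => rfl
      rw [h0', sub_zero]
      by_cases hs : s ∈ a +ᵥ primePowBall F N
      · rw [Set.indicator_of_mem hs, Set.indicator_of_mem hs, hX v s (hshell s hs), normInv_eq_of_mem_shell (hshell s hs), mul_one]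
      · simp [hs]
    rw [h]
    exact (integrable_indicator_iff (measurableSet_vadd_primePowBall N a)).2
      ((integrableOn_const_iff enorm_ne_top).2 (Or.inr (isCompact_vadd_primePowBall N a).measure_lt_top))

/-! ## §3  (T1) The line inversion for Schwartz–Bruhat functions -/

open scoped Classical in
include hXm hXb hX hX0 hϖ hψc hm in
/-- **(T1) LINE INVERSION, sign-weight form.**  For every Schwartz–Bruhat `G`,
`∫ X(t) Ĝ(t) dμ(t) = γ₀ · (Z₀(G) + c₀ · G(0))` with `γ₀ = 2(−1)^m μ(𝔭^m)∕(1+q⁻¹)`, `c₀ = (1−q⁻¹)μ(𝒪)∕2` and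
`Z₀(G) = ∫ X(s) ‖s‖⁻¹ (G(s) − 1_𝒪(s) G(0)) dμ(s)` — the distributional Fourier transform of the unramified quadratic character on the line is `γ₀ (χ|·|⁻¹)_reg + γ₀ c₀ δ₀`.
Proof: finite coset decomposition of `G` (★) and the per-coset identity, both sides being linear. [cite: Tate1950, §2.5] [cite: BushnellHenniart2006, §23.5] [cite: WeilBNT1967, Ch. VII §2] -/
theorem integral_sign_mul_fourierSB_eq {G : F → ℂ} (hG : G ∈ SchwartzBruhat F) :
    ∫ t, X t * fourierSB ψ μ G t ∂μ =
      (2 * (-1) ^ m * (μ.real (primePowBall F m) : ℂ) / (1 + (residueFieldCard F : ℂ)⁻¹)) *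
        ((∫ s, X s * ((((normAbs F s)⁻¹ : ℝ≥0) : ℝ) : ℂ) * (G s - (primePowBall F 0).indicator (fun _ => G 0) s) ∂μ) +
          ((1 - (residueFieldCard F : ℂ)⁻¹) * (μ.real (primePowBall F 0) : ℂ) / 2) * G 0) := by
  obtain ⟨N, C, rep, hrep, hsum⟩ := exists_finset_eq_sum_const_mul_indicator hG
  -- (i) the Fourier side is the finite sum of the coset transforms
  have hGf : G = fun u => ∑ B ∈ C, G (rep B) * B.indicator (fun _ => (1 : ℂ)) u := funext hsum
  have hF : fourierSB ψ μ G = fun y => ∑ B ∈ C, G (rep B) * fourierSB ψ μ (B.indicator fun _ => (1 : ℂ)) y := by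
    rw [congrArg (fourierSB ψ μ) hGf,
      fourierSB_finset_sum μ hψc C (fun B u => G (rep B) * B.indicator (fun _ => (1 : ℂ)) u)
        (fun B hB => integrable_const_mul_indicator_of_eq μ (hrep B hB) _)]
    funext y
    refine Finset.sum_congr rfl fun B _ => ?_
    rw [fourierSB_const_mul]
  have hLHS : ∫ t, X t * fourierSB ψ μ G t ∂μ =
      ∑ B ∈ C, G (rep B) * ∫ t, X t * fourierSB ψ μ (B.indicator fun _ => (1 : ℂ)) t ∂μ := by
    rw [hF]
    simp_rw [Finset.mul_sum]
    rw [integral_finsetSum C (fun B hB => ?_)]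
    · refine Finset.sum_congr rfl fun B _ => ?_
      rw [← integral_const_mul]
      refine integral_congr_ae (Filter.Eventually.of_forall fun t => ?_)
      simp only
      ring
    · have hi : Integrable (fourierSB ψ μ (B.indicator fun _ => (1 : ℂ))) μ := by
        rw [hrep B hB]; exact integrable_fourierSB_indicator_vadd_primePowBall μ hψc hm (rep B) N
      exact (hi.const_mul (G (rep B))).bdd_mul (c := 1) hXm.aestronglyMeasurable (Filter.Eventually.of_forall hXb)
  -- (ii) the regularised side is the finite sum of the coset values
  have hZf : (fun s => X s * ((((normAbs F s)⁻¹ : ℝ≥0) : ℝ) : ℂ) * (G s - (primePowBall F 0).indicator (fun _ => G 0) s)) =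
      fun s => ∑ B ∈ C, G (rep B) * (X s * ((((normAbs F s)⁻¹ : ℝ≥0) : ℝ) : ℂ) *
        (B.indicator (fun _ => (1 : ℂ)) s - (primePowBall F 0).indicator (fun _ => B.indicator (fun _ => (1 : ℂ)) 0) s)) := by
    funext s
    have h1 : (primePowBall F 0).indicator (fun _ => G 0) s =
        ∑ B ∈ C, G (rep B) * (primePowBall F 0).indicator (fun _ => B.indicator (fun _ => (1 : ℂ)) 0) s := by
      by_cases hs : s ∈ primePowBall F 0
      · simp_rw [Set.indicator_of_mem hs]; exact hsum 0
      · simp [hs]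
    rw [hsum s, h1, ← Finset.sum_sub_distrib, Finset.mul_sum]
    refine Finset.sum_congr rfl fun B _ => ?_
    ring
  have hRHS : ∫ s, X s * ((((normAbs F s)⁻¹ : ℝ≥0) : ℝ) : ℂ) * (G s - (primePowBall F 0).indicator (fun _ => G 0) s) ∂μ =
      ∑ B ∈ C, G (rep B) * ∫ s, X s * ((((normAbs F s)⁻¹ : ℝ≥0) : ℝ) : ℂ) *
        (B.indicator (fun _ => (1 : ℂ)) s - (primePowBall F 0).indicator (fun _ => B.indicator (fun _ => (1 : ℂ)) 0) s) ∂μ := by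
    rw [hZf, integral_finsetSum C (fun B hB => (integrable_sign_mul_normInv_mul_indicator_of_eq μ hXm hXb hX (hrep B hB)).const_mul _)]
    refine Finset.sum_congr rfl fun B _ => ?_
    rw [integral_const_mul]
  -- (iii) assemble
  rw [hLHS, hRHS, hsum 0, mul_add, Finset.mul_sum, Finset.mul_sum, Finset.mul_sum, ← Finset.sum_add_distrib]
  refine Finset.sum_congr rfl fun B hB => ?_
  rw [integral_sign_mul_fourierSB_indicator_eq_of_eq μ hXm hXb hX hX0 hϖ ψ hψc hm (hrep B hB)]
  ring

open scoped Classical in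
include hXm hXb hX hX0 hϖ hψc hm in
/-- **(T1), `∃`-form of the frozen (G⁺-b) interface**: there are constants `γ₀ c₀` (namely `2(−1)^m μ(𝔭^m)∕(1+q⁻¹)` and `(1−q⁻¹)μ(𝒪)∕2`) with
`∫ X·Ĝ = γ₀ (Z₀(G) + c₀ G(0))` for all Schwartz–Bruhat `G`. [cite: Tate1950, §2.5] -/
theorem exists_lineInversion_consts :
    ∃ γ₀ c₀ : ℂ, ∀ G ∈ SchwartzBruhat F,
      ∫ t, X t * fourierSB ψ μ G t ∂μ =
        γ₀ * ((∫ s, X s * ((((normAbs F s)⁻¹ : ℝ≥0) : ℝ) : ℂ) * (G s - (primePowBall F 0).indicator (fun _ => G 0) s) ∂μ) + c₀ * G 0) :=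
  ⟨_, _, fun _ hG => integral_sign_mul_fourierSB_eq μ hXm hXb hX hX0 hϖ ψ hψc hm hG⟩

/-! ## §4  (T2) The truncation identity (strict set, even exponents) -/

open scoped Classical in
include hXm hXb hX in
/-- **(T2) TRUNCATION IDENTITY.**  For Schwartz–Bruhat `G`, eventually in `n`,
`∫_{(𝔭^{2n})ᶜ} X(s) ‖s‖⁻¹ G(s) dμ(s) = Z₀(G)` EXACTLY: on `𝔭^{2n}` (inside the constancy ball of `G` and inside `𝒪`) the regularised integrand vanishes, and the
`G(0)`-term over `𝒪 ∖ 𝔭^{2n}` is the alternating sum over `2n` shells, which is `0`. [cite: Tate1950, §2.5] -/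
theorem setIntegral_compl_primePowBall_even_eventually_eq {G : F → ℂ} (hG : G ∈ SchwartzBruhat F) :
    ∀ᶠ n : ℕ in atTop, ∫ s in (primePowBall F (2 * n : ℤ))ᶜ, X s * ((((normAbs F s)⁻¹ : ℝ≥0) : ℝ) : ℂ) * G s ∂μ =
      ∫ s, X s * ((((normAbs F s)⁻¹ : ℝ≥0) : ℝ) : ℂ) * (G s - (primePowBall F 0).indicator (fun _ => G 0) s) ∂μ := by
  haveI : T2Space F := (isLocalField F).toT2Space
  haveI : LocallyCompactSpace F := (isLocalField F).toLocallyCompactSpace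
  obtain ⟨N, hN⟩ := exists_forall_add_eq_of_mem_schwartzBruhat hG
  obtain ⟨CG, _, hCG⟩ := exists_norm_le_of_mem_schwartzBruhat hG
  have hGi : Integrable G μ := ((mem_schwartzBruhat_iff).1 hG).1.continuous.integrable_of_hasCompactSupport ((mem_schwartzBruhat_iff).1 hG).2
  refine Filter.eventually_atTop.2 ⟨N.toNat, fun n hn => ?_⟩
  have h2n : N ≤ (2 * n : ℤ) := by have := Int.self_le_toNat N; omega
  -- the regularised integrand vanishes on `𝔭^{2n}`
  have hvan : ∀ s, s ∉ (primePowBall F (2 * n : ℤ))ᶜ →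
      X s * ((((normAbs F s)⁻¹ : ℝ≥0) : ℝ) : ℂ) * (G s - (primePowBall F 0).indicator (fun _ => G 0) s) = 0 := by
    intro s hs'
    have hs : s ∈ primePowBall F (2 * n : ℤ) := by simpa using hs'
    have hs0 : s ∈ primePowBall F 0 := primePowBall_antitone (by omega) hs
    have hsN : s ∈ primePowBall F N := primePowBall_antitone h2n hs
    have hG0 : G s = G 0 := by have := hN 0 s hsN; rwa [zero_add] at this
    rw [Set.indicator_of_mem hs0, hG0, sub_self, mul_zero]
  rw [← setIntegral_eq_integral_of_forall_compl_eq_zero hvan]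
  have hmeas : MeasurableSet (primePowBall F (2 * n : ℤ))ᶜ := (measurableSet_primePowBall _).compl
  -- integrability on the truncated region
  have hI1 : IntegrableOn (fun s => X s * ((((normAbs F s)⁻¹ : ℝ≥0) : ℝ) : ℂ) * G s) (primePowBall F (2 * n : ℤ))ᶜ μ := by
    refine (hGi.integrableOn).bdd_mul (c := (residueFieldCard F : ℝ) ^ (2 * n : ℤ))
      ((hXm.mul measurable_normInv).aestronglyMeasurable) ?_
    rw [ae_restrict_iff' hmeas]
    refine Filter.Eventually.of_forall fun s hs => ?_
    rw [norm_mul]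
    calc ‖X s‖ * ‖((((normAbs F s)⁻¹ : ℝ≥0) : ℝ) : ℂ)‖ ≤ 1 * (residueFieldCard F : ℝ) ^ (2 * n : ℤ) :=
          mul_le_mul (hXb s) (norm_normInv_le hs) (norm_nonneg _) zero_le_one
      _ = (residueFieldCard F : ℝ) ^ (2 * n : ℤ) := one_mul _
  have hind : (fun s => X s * ((((normAbs F s)⁻¹ : ℝ≥0) : ℝ) : ℂ) * (primePowBall F 0).indicator (fun _ => G 0) s) =
      (primePowBall F 0).indicator (fun s => G 0 * (X s * ((((normAbs F s)⁻¹ : ℝ≥0) : ℝ) : ℂ))) := by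
    funext s
    by_cases hs : s ∈ primePowBall F 0
    · rw [Set.indicator_of_mem hs, Set.indicator_of_mem hs]; ring
    · simp [hs]
  have hset : (primePowBall F (2 * n : ℤ))ᶜ ∩ primePowBall F 0 = primePowBall F 0 \ primePowBall F (0 + (2 * n : ℕ)) := by
    rw [Set.sdiff_eq_compl_inter, zero_add, Nat.cast_mul, Nat.cast_ofNat]
  have hI2 : IntegrableOn (fun s => X s * ((((normAbs F s)⁻¹ : ℝ≥0) : ℝ) : ℂ) * (primePowBall F 0).indicator (fun _ => G 0) s)
      (primePowBall F (2 * n : ℤ))ᶜ μ := by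
    rw [hind, IntegrableOn, integrable_indicator_iff (measurableSet_primePowBall 0), IntegrableOn,
      Measure.restrict_restrict (measurableSet_primePowBall 0), Set.inter_comm, hset]
    exact ((integrableOn_sign_mul_normInv μ hXm hXb 0 _).const_mul (G 0))
  have hzero : ∫ s in (primePowBall F (2 * n : ℤ))ᶜ, X s * ((((normAbs F s)⁻¹ : ℝ≥0) : ℝ) : ℂ) *
      (primePowBall F 0).indicator (fun _ => G 0) s ∂μ = 0 := by
    rw [hind, setIntegral_indicator (measurableSet_primePowBall 0), hset, integral_const_mul,
      setIntegral_sdiff_sign_mul_normInv μ hXm hXb hX 0 (2 * n)]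
    have h1 : ((-1 : ℂ)) ^ ((0 : ℤ) + ((2 * n : ℕ) : ℤ)) = 1 := by
      rw [zero_add, Nat.cast_mul, Nat.cast_ofNat, zpow_mul]; norm_num
    rw [h1, zpow_zero, sub_self, zero_div, mul_zero, mul_zero]
  simp_rw [mul_sub]
  rw [integral_sub hI1 hI2, hzero, sub_zero]

end Summit.HodgeConjecture.HodgeConjecture.Cruxes.H413.K2E3LocalFieldQuadraticCharLineInversion
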